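import Summits.HodgeConjecture.HodgeConjecture.Theorems.Ring2WeilCoverageFullSignature
import HarnessLib

/-!
# Weil-type family coverage — THE COMPLETE LAW UNDER THEOREM L (ii) ALONE: on `ℂ^Φ/D(𝔪)` the type `𝔣₀` of a skew `ζ₀`
# occurs iff (`#{φ ∈ Φ : Im ζ₀^φ < 0}` is even OR some unit of `K⁺` has norm `−1`); the dichotomy «THEOREM L (i) holds and
# the norm-sign law is two-sided» / «THEOREM L (i) fails and every type occurs»

research route conditional on HC_CM; not a corollary; Q11.4-sentence-2 already refuted in dim ≥ 3.

Ring 2, WEIL-TYPE FAMILY-COVERAGE CENSUS (`HOME/WEIL-FAMILY-COVERAGE.md` `## b01`, blocks b01.28 THEOREM L, b01.42–b01.43;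
owner ring2-b01), part 60b of the `Ring2WeilCoverage*` series.  Part 55 proved the two-sided law under THEOREM L (i) AND
(ii); part 60 proved «every type» under THEOREM L (ii) and ONE odd unit.  This file closes the circle for a general CM field
`K` and CM type `Φ` satisfying THEOREM L (ii) on `Φ` (`hU'`: every even sign pattern is a real unit's):

* §1 `exists_units_odd_of_norm_neg`: a unit `v` of `𝓞 K⁺` with `N_{K⁺/ℚ}(v) < 0` is, in `𝓞 K`, a real unit negative at
  an ODD number of members of EVERY CM type (part 55 `norm_neg_iff_odd_ncard`); hence
  `forall_exists_units_sign_eq_of_norm_neg` (`hU'` + such a `v` ⟹ every pattern on `Φ`) and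
  **`forall_sign_iff_exists_norm_neg`**: under `hU'`, «every sign pattern on `Φ` is a real unit's» ⟺ «THEOREM L (i)
  fails» (`∃ v`, `N(v) < 0`) — so «full signature on `Φ`» does not depend on `Φ`; `not_exists_norm_neg_iff_forall_norm_pos`
  (the two shapes of THEOREM L (i)).
* §2 **`exists_pos_isOfType_iff_even_or_exists_norm_neg`** — THE COMPLETE LAW UNDER THEOREM L (ii): for a skew `ζ₀ ≠ 0`
  of type `𝔣₀`, «`ℂ^Φ/D(𝔪)` carries a `Φ`-positive divisor of type `𝔣₀`» ⟺ (`#{φ ∈ Φ : Im ζ₀^φ < 0}` even ∨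
  `∃ v ∈ (𝓞 K⁺)ˣ, N_{K⁺/ℚ}(v) < 0`); **`exists_pos_isOfType_realMul_iff_or`**: «type `(ϖ₀)𝔣₀` occurs» ⟺ ((«type
  `𝔣₀` occurs» ⟺ `N(ϖ₀) > 0`) ∨ THEOREM L (i) fails) — part 55's norm-sign law and part 60's degenerate case in one
  statement; `exists_pos_isOfType_iff_exists_norm_neg_of_odd`: a type whose skew representative has an ODD negative count
  on `Φ` occurs ⟺ THEOREM L (i) fails.
* §3 the cyclotomic principal torus: `exists_principal_iff_even_or` («principal» ⟺ `|S_Φ ∩ N_odd|` even ∨ L (i) fails),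
  **`exists_type_span_iff_or`**: «type `(ϖ₀)` on `ℂ^Φ/Φ(ℤ[ζₙ])`» ⟺ ((`|S_Φ ∩ N_odd|` even ⟺ `N(ϖ₀) > 0`) ∨ THEOREM L (i)
  fails for `ℚ(ζₙ)`).

At the census levels THEOREM L (ii) is a tree theorem everywhere (parts 15–23), THEOREM L (i) holds at the 13
non-prime-power levels (parts 8/9/10/31/57/63) and fails at `32` (part 61): the disjunction is decided level by level,
but the statements here are the ones that hold uniformly.

HONEST FRAMING: torus-level statements about Shimura's divisors of type `(K; Φ; 𝔣₀)` [Sh98 §14.3 Prop. 4–5] and units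
of `K⁺`; nothing here is a statement about Hodge classes, `W_K`, general members or HC; `HC_CM` is used nowhere.  No
`def`, no named fact, no `sorry`.

References: [cite: Shimura1998, §14.3 Prop. 4–5, pp. 103–104]; census b01.42–b01.43 (seat-derived).
-/

noncomputable section

open scoped Classical nonZeroDivisors NumberField ComplexConjugate
open NumberField NumberField.ComplexEmbedding Module FractionalIdeal Complex Polynomial

namespace Summit.HodgeConjecture.Ring2WeilCoverage.FullSignatureDichotomy

open Literature.AlgebraicGeometry.Motives (CMType)
open Literature.NumberTheory.ComplexMultiplication
open Literature.NumberTheory.ComplexMultiplication.CMTypeLattice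
open Summit.HodgeConjecture.Ring2WeilCoverage.CMTypeSignParity
open Summit.HodgeConjecture.Ring2WeilCoverage.CMUnitSignature
open Summit.HodgeConjecture.Ring2WeilCoverage.TypeNormSign
open Summit.HodgeConjecture.Ring2WeilCoverage.FullSignature

section General

variable {K : Type} [Field K] [NumberField K] [IsCMField K] (Φ : CMType K)
  (𝔪 : (FractionalIdeal (𝓞 K)⁰ K)ˣ) {ζ₀ : K} {𝔣₀ : Ideal (𝓞 (maximalRealSubfield K))}

/-- the image in `K` of an integer `ϖ₀` of the maximal real subfield. -/
local notation3 (prettyPrint := false) "𝓇 " x:max => (algebraMap (𝓞 (maximalRealSubfield K)) K x)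

/-! ### §1 A unit of negative norm is an odd unit on every CM type -/

/-- **A unit `v` of `𝓞 K⁺` with `N_{K⁺/ℚ}(v) < 0` gives a unit of `𝓞 K` fixed by `ρ` which is negative at an ODD number of
members of the CM type `Φ`** (part 55 `norm_neg_iff_odd_ncard`, for every `Φ`).
research route conditional on HC_CM; not a corollary; Q11.4-sentence-2 already refuted in dim ≥ 3. [folklore] -/
theorem exists_units_odd_of_norm_neg {v : (𝓞 (maximalRealSubfield K))ˣ}
    (hv : Algebra.norm ℚ (((v : 𝓞 (maximalRealSubfield K)) : maximalRealSubfield K)) < 0) :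
    ∃ u : (𝓞 K)ˣ, IsCMField.complexConj K ((u : 𝓞 K) : K) = ((u : 𝓞 K) : K) ∧
      Odd ((Φ.1 ∩ {ψ : K →+* ℂ | (ψ ((u : 𝓞 K) : K)).re < 0}).ncard) := by
  refine ⟨Units.map (algebraMap (𝓞 (maximalRealSubfield K)) (𝓞 K)).toMonoidHom v, ?_, ?_⟩
  · exact (IsCMField.Units.complexConj_eq_self_iff K _).mpr ⟨v, by
      simp [IsScalarTower.algebraMap_apply (𝓞 (maximalRealSubfield K)) (𝓞 K) K]⟩
  · have h : (((Units.map (algebraMap (𝓞 (maximalRealSubfield K)) (𝓞 K)).toMonoidHom v : (𝓞 K)ˣ) : 𝓞 K) : K) =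
        𝓇 (v : 𝓞 (maximalRealSubfield K)) := by
      simp [IsScalarTower.algebraMap_apply (𝓞 (maximalRealSubfield K)) (𝓞 K) K]
    rw [h]
    exact (norm_neg_iff_odd_ncard Φ v.ne_zero).mp hv

/-- **THEOREM L (ii) on `Φ` + a unit of `K⁺` of negative norm ⟹ EVERY sign pattern on `Φ` is a real unit's** (part 60
`forall_exists_units_sign_eq_of_odd` with the odd unit of §1).
research route conditional on HC_CM; not a corollary; Q11.4-sentence-2 already refuted in dim ≥ 3. [folklore] -/
theorem forall_exists_units_sign_eq_of_norm_neg
    (hU' : ∀ S : Set (K →+* ℂ), S ⊆ Φ.1 → Even S.ncard →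
      ∃ u : (𝓞 K)ˣ, IsCMField.complexConj K ((u : 𝓞 K) : K) = ((u : 𝓞 K) : K) ∧
        ∀ φ ∈ Φ.1, ((φ ((u : 𝓞 K) : K)).re < 0 ↔ φ ∈ S))
    {v : (𝓞 (maximalRealSubfield K))ˣ}
    (hv : Algebra.norm ℚ (((v : 𝓞 (maximalRealSubfield K)) : maximalRealSubfield K)) < 0)
    (S : Set (K →+* ℂ)) (hS : S ⊆ Φ.1) :
    ∃ u : (𝓞 K)ˣ, IsCMField.complexConj K ((u : 𝓞 K) : K) = ((u : 𝓞 K) : K) ∧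
      ∀ φ ∈ Φ.1, ((φ ((u : 𝓞 K) : K)).re < 0 ↔ φ ∈ S) := by
  obtain ⟨u₁, hu₁, hodd⟩ := exists_units_odd_of_norm_neg Φ hv
  exact forall_exists_units_sign_eq_of_odd Φ hU' hu₁ hodd S hS

/-- **Under THEOREM L (ii) on `Φ`: «every sign pattern on `Φ` is a real unit's» ⟺ «THEOREM L (i) fails»** (some unit of
`𝓞 K⁺` has negative norm) — §1 one way, part 60 `exists_realUnits_norm_neg_of_forall_sign` the other.
research route conditional on HC_CM; not a corollary; Q11.4-sentence-2 already refuted in dim ≥ 3. [folklore] -/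
theorem forall_sign_iff_exists_norm_neg
    (hU' : ∀ S : Set (K →+* ℂ), S ⊆ Φ.1 → Even S.ncard →
      ∃ u : (𝓞 K)ˣ, IsCMField.complexConj K ((u : 𝓞 K) : K) = ((u : 𝓞 K) : K) ∧
        ∀ φ ∈ Φ.1, ((φ ((u : 𝓞 K) : K)).re < 0 ↔ φ ∈ S)) :
    (∀ S : Set (K →+* ℂ), S ⊆ Φ.1 →
      ∃ u : (𝓞 K)ˣ, IsCMField.complexConj K ((u : 𝓞 K) : K) = ((u : 𝓞 K) : K) ∧
        ∀ φ ∈ Φ.1, ((φ ((u : 𝓞 K) : K)).re < 0 ↔ φ ∈ S)) ↔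
      ∃ v : (𝓞 (maximalRealSubfield K))ˣ,
        Algebra.norm ℚ (((v : 𝓞 (maximalRealSubfield K)) : maximalRealSubfield K)) < 0 :=
  ⟨fun hU => exists_realUnits_norm_neg_of_forall_sign Φ hU,
    fun ⟨_, hv⟩ => forall_exists_units_sign_eq_of_norm_neg Φ hU' hv⟩

omit [IsCMField K] in
/-- THEOREM L (i) in its two shapes: «no unit of negative norm» ⟺ «every unit has positive norm» (the norm of a unit is
`±1`, never `0`).
research route conditional on HC_CM; not a corollary; Q11.4-sentence-2 already refuted in dim ≥ 3. [folklore] -/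
theorem not_exists_norm_neg_iff_forall_norm_pos :
    (¬ ∃ v : (𝓞 (maximalRealSubfield K))ˣ,
        Algebra.norm ℚ (((v : 𝓞 (maximalRealSubfield K)) : maximalRealSubfield K)) < 0) ↔
      ∀ v : (𝓞 (maximalRealSubfield K))ˣ,
        0 < Algebra.norm ℚ (((v : 𝓞 (maximalRealSubfield K)) : maximalRealSubfield K)) := by
  constructor
  · intro h v
    have hne : Algebra.norm ℚ (((v : 𝓞 (maximalRealSubfield K)) : maximalRealSubfield K)) ≠ 0 := by
      rw [Algebra.norm_ne_zero_iff]
      intro h0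
      apply v.ne_zero
      exact_mod_cast h0
    rcases lt_trichotomy (Algebra.norm ℚ (((v : 𝓞 (maximalRealSubfield K)) : maximalRealSubfield K))) 0 with
      hlt | heq | hgt
    · exact absurd ⟨v, hlt⟩ h
    · exact absurd heq hne
    · exact hgt
  · rintro h ⟨v, hv⟩
    exact lt_asymm hv (h v)

/-! ### §2 The complete law under THEOREM L (ii) -/

/-- **THE COMPLETE LAW UNDER THEOREM L (ii) ALONE.**  For a skew `ζ₀ ≠ 0` of type `𝔣₀` on `D(𝔪)` and a CM type `Φ`
satisfying THEOREM L (ii): **`ℂ^Φ/D(𝔪)` carries a `Φ`-positive divisor of type `(K; Φ; 𝔣₀)` iff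
(`#{φ ∈ Φ : Im ζ₀^φ < 0}` is even OR some unit of `𝓞 K⁺` has negative norm)** — if THEOREM L (i) holds this is part 55's
`exists_pos_isOfType_iff_even`, if it fails every type occurs (part 60).
research route conditional on HC_CM; not a corollary; Q11.4-sentence-2 already refuted in dim ≥ 3. [cite: Shimura1998, §14.3 Prop. 4–5, pp. 103–104] -/
theorem exists_pos_isOfType_iff_even_or_exists_norm_neg (hζ₀ : IsCMField.complexConj K ζ₀ = -ζ₀) (h0 : ζ₀ ≠ 0)
    (hT : IsOfType 𝔪 ζ₀ 𝔣₀)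
    (hU' : ∀ S : Set (K →+* ℂ), S ⊆ Φ.1 → Even S.ncard →
      ∃ u : (𝓞 K)ˣ, IsCMField.complexConj K ((u : 𝓞 K) : K) = ((u : 𝓞 K) : K) ∧
        ∀ φ ∈ Φ.1, ((φ ((u : 𝓞 K) : K)).re < 0 ↔ φ ∈ S)) :
    (∃ ζ : K, IsCMField.complexConj K ζ = -ζ ∧ (∀ φ : Φ.1, 0 < (φ.1 ζ).im) ∧ IsOfType 𝔪 ζ 𝔣₀) ↔
      (Even ((Φ.1 ∩ {ψ : K →+* ℂ | (ψ ζ₀).im < 0}).ncard) ∨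
        ∃ v : (𝓞 (maximalRealSubfield K))ˣ,
          Algebra.norm ℚ (((v : 𝓞 (maximalRealSubfield K)) : maximalRealSubfield K)) < 0) := by
  by_cases hex : ∃ v : (𝓞 (maximalRealSubfield K))ˣ,
      Algebra.norm ℚ (((v : 𝓞 (maximalRealSubfield K)) : maximalRealSubfield K)) < 0
  · obtain ⟨v, hv⟩ := hex
    exact ⟨fun _ => Or.inr ⟨v, hv⟩, fun _ =>
      exists_pos_isOfType_of_forall_sign Φ 𝔪 hζ₀ h0 hT (forall_exists_units_sign_eq_of_norm_neg Φ hU' hv)⟩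
  · have hN := (not_exists_norm_neg_iff_forall_norm_pos (K := K)).mp hex
    rw [exists_pos_isOfType_iff_even Φ 𝔪 hζ₀ h0 hT hN hU']
    exact ⟨fun h => Or.inl h, fun h => h.resolve_right hex⟩

/-- **THE NORM-SIGN LAW WITH ITS DEGENERATE CASE.**  Under THEOREM L (ii) on `Φ`, for a skew `ζ₀ ≠ 0` of type `𝔣₀` and a
real `ϖ₀ ∈ 𝓞 K⁺ ∖ 0`: **«type `(ϖ₀)𝔣₀` occurs on `ℂ^Φ/D(𝔪)`» ⟺ ((«type `𝔣₀` occurs» ⟺ `N_{K⁺/ℚ}(ϖ₀) > 0`) ∨ THEOREM L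
(i) fails)** — part 55's two-sided law when every unit has positive norm, «everything occurs» otherwise.
research route conditional on HC_CM; not a corollary; Q11.4-sentence-2 already refuted in dim ≥ 3. [cite: Shimura1998, §14.3 Prop. 4–5, pp. 103–104] -/
theorem exists_pos_isOfType_realMul_iff_or (hζ₀ : IsCMField.complexConj K ζ₀ = -ζ₀) (h0 : ζ₀ ≠ 0)
    (hT : IsOfType 𝔪 ζ₀ 𝔣₀) {ϖ₀ : 𝓞 (maximalRealSubfield K)} (hϖ0 : ϖ₀ ≠ 0)
    (hU' : ∀ S : Set (K →+* ℂ), S ⊆ Φ.1 → Even S.ncard →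
      ∃ u : (𝓞 K)ˣ, IsCMField.complexConj K ((u : 𝓞 K) : K) = ((u : 𝓞 K) : K) ∧
        ∀ φ ∈ Φ.1, ((φ ((u : 𝓞 K) : K)).re < 0 ↔ φ ∈ S)) :
    (∃ ζ : K, IsCMField.complexConj K ζ = -ζ ∧ (∀ φ : Φ.1, 0 < (φ.1 ζ).im) ∧
        IsOfType 𝔪 ζ (Ideal.span {ϖ₀} * 𝔣₀)) ↔
      (((∃ ζ : K, IsCMField.complexConj K ζ = -ζ ∧ (∀ φ : Φ.1, 0 < (φ.1 ζ).im) ∧ IsOfType 𝔪 ζ 𝔣₀) ↔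
          0 < Algebra.norm ℚ ((ϖ₀ : maximalRealSubfield K))) ∨
        ∃ v : (𝓞 (maximalRealSubfield K))ˣ,
          Algebra.norm ℚ (((v : 𝓞 (maximalRealSubfield K)) : maximalRealSubfield K)) < 0) := by
  by_cases hex : ∃ v : (𝓞 (maximalRealSubfield K))ˣ,
      Algebra.norm ℚ (((v : 𝓞 (maximalRealSubfield K)) : maximalRealSubfield K)) < 0
  · obtain ⟨v, hv⟩ := hex
    exact ⟨fun _ => Or.inr ⟨v, hv⟩, fun _ =>
      exists_pos_isOfType_realMul_of_forall_sign Φ 𝔪 hζ₀ h0 hT hϖ0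
        (forall_exists_units_sign_eq_of_norm_neg Φ hU' hv)⟩
  · have hN := (not_exists_norm_neg_iff_forall_norm_pos (K := K)).mp hex
    rw [exists_pos_isOfType_realMul_iff Φ 𝔪 hζ₀ h0 hT hϖ0 hN hU']
    exact ⟨fun h => Or.inl h, fun h => h.resolve_right hex⟩

/-- **THE DICHOTOMY, type by type**: under THEOREM L (ii) on `Φ`, a skew `ζ₀ ≠ 0` of type `𝔣₀` with an ODD negative count
on `Φ` gives a `Φ`-positive divisor of type `𝔣₀` on `ℂ^Φ/D(𝔪)` IFF THEOREM L (i) fails.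
research route conditional on HC_CM; not a corollary; Q11.4-sentence-2 already refuted in dim ≥ 3. [cite: Shimura1998, §14.3 Prop. 5, p. 104] -/
theorem exists_pos_isOfType_iff_exists_norm_neg_of_odd (hζ₀ : IsCMField.complexConj K ζ₀ = -ζ₀) (h0 : ζ₀ ≠ 0)
    (hT : IsOfType 𝔪 ζ₀ 𝔣₀)
    (hU' : ∀ S : Set (K →+* ℂ), S ⊆ Φ.1 → Even S.ncard →
      ∃ u : (𝓞 K)ˣ, IsCMField.complexConj K ((u : 𝓞 K) : K) = ((u : 𝓞 K) : K) ∧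
        ∀ φ ∈ Φ.1, ((φ ((u : 𝓞 K) : K)).re < 0 ↔ φ ∈ S))
    (hodd : Odd ((Φ.1 ∩ {ψ : K →+* ℂ | (ψ ζ₀).im < 0}).ncard)) :
    (∃ ζ : K, IsCMField.complexConj K ζ = -ζ ∧ (∀ φ : Φ.1, 0 < (φ.1 ζ).im) ∧ IsOfType 𝔪 ζ 𝔣₀) ↔
      ∃ v : (𝓞 (maximalRealSubfield K))ˣ,
        Algebra.norm ℚ (((v : 𝓞 (maximalRealSubfield K)) : maximalRealSubfield K)) < 0 := by
  rw [exists_pos_isOfType_iff_even_or_exists_norm_neg Φ 𝔪 hζ₀ h0 hT hU']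
  have hne := Nat.not_even_iff_odd.mpr hodd
  exact ⟨fun h => h.resolve_left hne, fun h => Or.inr h⟩

end General

/-! ### §3 The cyclotomic principal torus -/

section Cyclotomic

open Summit.HodgeConjecture.Ring2WeilCoverage.CyclotomicDifferent
open Summit.HodgeConjecture.Ring2WeilCoverage.CyclotomicPrincipalObstruction

variable {K : Type} [Field K] [NumberField K] {n : ℕ} [NeZero n] {ζ : K}

/-- `𝐞(t) = exp(2πi t/n) ∈ ℂ` (`ZMod.toCircle`). -/
local notation3 (prettyPrint := false) "𝐞 " t:max => ((ZMod.toCircle t : Circle) : ℂ)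

/-- The census's set `N_odd` = the unit residues at odd positions (`below` even), part 5. -/
local notation3 (prettyPrint := false) "Nodd" =>
  (Finset.univ.filter fun t : ZMod n => t.val.Coprime n ∧
    Even (Finset.card (Finset.filter (fun s : ZMod n => s.val.Coprime n ∧ s.val < t.val) Finset.univ)))

open scoped Classical in
/-- **PRINCIPAL POLARISATIONS ON `ℂ^Φ/Φ(ℤ[ζₙ])` UNDER THEOREM L (ii) ALONE: ⟺ (`|S_Φ ∩ N_odd|` even ∨ THEOREM L (i) fails
for `ℚ(ζₙ)`)** (reference `ξ_k = ζ^k/Φₙ′(ζ)`, `#{φ ∈ Φ : Im ξ^φ < 0} = |S_Φ ∩ N_odd|` by parts 6/7).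
research route conditional on HC_CM; not a corollary; Q11.4-sentence-2 already refuted in dim ≥ 3. [cite: Shimura1998, §14.3 Prop. 5, p. 104] -/
theorem exists_principal_iff_even_or [IsCyclotomicExtension {n} ℚ K] [IsCMField K] (hζ : IsPrimitiveRoot ζ n)
    {k : ℕ} (hg : Nat.totient n = 2 * (k + 1)) (Φ : CMType K)
    (hU' : ∀ S : Set (K →+* ℂ), S ⊆ Φ.1 → Even S.ncard →
      ∃ u : (𝓞 K)ˣ, IsCMField.complexConj K ((u : 𝓞 K) : K) = ((u : 𝓞 K) : K) ∧
        ∀ φ ∈ Φ.1, ((φ ((u : 𝓞 K) : K)).re < 0 ↔ φ ∈ S)) :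
    (∃ ζ' : K, IsCMField.complexConj K ζ' = -ζ' ∧ (∀ φ : Φ.1, 0 < (φ.1 ζ').im) ∧
        IsOfType (1 : (FractionalIdeal (𝓞 K)⁰ K)ˣ) ζ' ⊤) ↔
      (Even ((Finset.univ.filter fun t : ZMod n => ∃ σ ∈ Φ.1, σ ζ = 𝐞 t) ∩ Nodd).card ∨
        ∃ v : (𝓞 (maximalRealSubfield K))ˣ,
          Algebra.norm ℚ (((v : 𝓞 (maximalRealSubfield K)) : maximalRealSubfield K)) < 0) := by
  rw [exists_pos_isOfType_iff_even_or_exists_norm_neg Φ 1 (complexConj_xi hζ hg) (xi_ne_zero hζ k)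
      (isOfType_one_xi_top hζ k) hU', ncard_inter_negSet_eq_card_inter_nodd hζ hg Φ]

open scoped Classical in
/-- **TYPE `(ϖ₀)` ON `ℂ^Φ/Φ(ℤ[ζₙ])` UNDER THEOREM L (ii) ALONE: ⟺ ((`|S_Φ ∩ N_odd|` even ⟺ `N_{K⁺/ℚ}(ϖ₀) > 0`) ∨ THEOREM
L (i) fails for `ℚ(ζₙ)`)** — part 55b's `exists_type_span_iff_even_iff` with the degenerate case of parts 60/61 built
in: at the census levels the second disjunct is FALSE at the 13 non-prime-power levels and TRUE at `32`.
research route conditional on HC_CM; not a corollary; Q11.4-sentence-2 already refuted in dim ≥ 3. [cite: Shimura1998, §14.3 Prop. 4–5, pp. 103–104] -/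
theorem exists_type_span_iff_or [IsCyclotomicExtension {n} ℚ K] [IsCMField K] (hζ : IsPrimitiveRoot ζ n)
    {k : ℕ} (hg : Nat.totient n = 2 * (k + 1)) (Φ : CMType K) {ϖ₀ : 𝓞 (maximalRealSubfield K)} (hϖ0 : ϖ₀ ≠ 0)
    (hU' : ∀ S : Set (K →+* ℂ), S ⊆ Φ.1 → Even S.ncard →
      ∃ u : (𝓞 K)ˣ, IsCMField.complexConj K ((u : 𝓞 K) : K) = ((u : 𝓞 K) : K) ∧
        ∀ φ ∈ Φ.1, ((φ ((u : 𝓞 K) : K)).re < 0 ↔ φ ∈ S)) :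
    (∃ ζ' : K, IsCMField.complexConj K ζ' = -ζ' ∧ (∀ φ : Φ.1, 0 < (φ.1 ζ').im) ∧
        IsOfType (1 : (FractionalIdeal (𝓞 K)⁰ K)ˣ) ζ' (Ideal.span {ϖ₀})) ↔
      ((Even ((Finset.univ.filter fun t : ZMod n => ∃ σ ∈ Φ.1, σ ζ = 𝐞 t) ∩ Nodd).card ↔
          0 < Algebra.norm ℚ ((ϖ₀ : maximalRealSubfield K))) ∨
        ∃ v : (𝓞 (maximalRealSubfield K))ˣ,
          Algebra.norm ℚ (((v : 𝓞 (maximalRealSubfield K)) : maximalRealSubfield K)) < 0) := by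
  have h := exists_pos_isOfType_realMul_iff_or Φ 1 (complexConj_xi hζ hg) (xi_ne_zero hζ k)
    (isOfType_one_xi_top hζ k) hϖ0 hU'
  rw [Ideal.mul_top, exists_principal_iff_even_or hζ hg Φ hU'] at h
  rw [h]
  by_cases hex : ∃ v : (𝓞 (maximalRealSubfield K))ˣ,
      Algebra.norm ℚ (((v : 𝓞 (maximalRealSubfield K)) : maximalRealSubfield K)) < 0
  · simp only [hex, or_true]
  · simp only [hex, or_false]

end Cyclotomic

end Summit.HodgeConjecture.Ring2WeilCoverage.FullSignatureDichotomy

end
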